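import Summits.AnomalousDissipation.AnomalousDissipation.Theorems.SolenoidalFractalHomogenisationLagrangianStepVmodSSRegimesD
import HarnessLib

/-!
# K1L_D (stmt-AnomalousDissipation-27980): (V_mod) flat stage, block (ss) — SMALLNESS OF THE ONE-STEP CONSTANTS ON COARSE LABELS
(helper; `--supports 27980 --as helper`; prover ad-sawtooth-k1loc-p1 g15; discharges the hypotheses `hρ`, `hRP` of
`…VmodSSRegimesD.defect_le_alw_of_scale_iter` from the coarseness `‖ℓ‖⌈K/ν⌉ ≤ g₀·n` of the label, `ν ≤ ν_c`, and six explicit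
smallness conditions on `g₀` and one on `ν_c`.)

With `L = ‖ℓ‖ = √|ℓ|²`: coarseness and `⌈K/ν⌉ ≥ K/ν` give `L/(nν) ≤ g₀/K`, whence `u = RP ≤ 8π²(lo/Λ)M·Wp(1+c)g₀²/K²`,
`g ≤ g₀`, `cL^* ≤ (12k·e^{E₁}/(π²(lo/Λ)K))·g₀`, `3cS ≤ (24Σ‖α‖/(π(lo/Λ)K))·g₀`, `κ^* ≤ 16(1+c)g₀²/K²` (`e^{−x} ≤ 1/x`), and with
`e^{−1/2} < 0.61` the sum is `≤ 0.61 + 6/50 ≤ 3/4` (`coarse_smallness`).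
`sorry`-free; NOT a proof of (ss), of the stub, of K1L_D or of AD; rung F-D1.A0.
-/

set_option linter.dupNamespace false

noncomputable section

namespace Summit.AnomalousDissipation.AnomalousDissipation.Theorems.SolenoidalFractalHomogenisation.LagrangianStep.VmodGen

open Set MeasureTheory Complex UnitAddTorus
open scoped InnerProductSpace ENNReal
open Literature.Analysis Literature.Analysis.FunctionSpaces Literature.Analysis.FunctionSpaces.Torus
open Literature.Analysis.FluidPDE Literature.Analysis.FluidPDE.Torus Literature.Analysis.FluidPDE.LatticeShear
open Summit.AnomalousDissipation.AnomalousDissipation.Theorems.SolenoidalFractalHomogenisation.LagrangianStep.Sideband (slotAmp)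
open Summit.AnomalousDissipation.AnomalousDissipation.Theorems.SolenoidalFractalHomogenisation.LagrangianStep.VmodFlat (loT)

variable {k : ℕ}

set_option maxHeartbeats 3200000 in
/-- **Smallness of the one-step constants on coarse labels.**  See the module docstring. -/
theorem coarse_smallness (W : LatticeWord k) {C σ c lo hi Λ M ν K g₀ νc : ℝ} {n : ℕ} {ℓ : Fin 3 → ℤ}
    (hC : 0 ≤ C) (hσ : 0 < σ) (hc : 0 < c) (hlo : 0 < lo) (hhi : 0 ≤ hi) (hΛ : 1 ≤ Λ) (hM : 0 < M)
    (hν : 0 < ν) (hν1 : ν ≤ 1) (hK : 0 < K) (hn : 1 ≤ n) (hℓ0 : ℓ ≠ 0) (hg₀ : 0 < g₀) (hg₀1 : g₀ ≤ 1)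
    (hνc : ν ≤ νc) (hcoarse : ‖Torus.latticeVec ℓ‖ * (⌈K / ν⌉₊ : ℝ) ≤ g₀ * n)
    (hgσ : 2 * Real.sqrt 2 * C ^ 2 * g₀ ^ σ ≤ 1 / 50) (hνcσ : 2 * Real.sqrt 2 * C ^ 2 * νc ^ σ ≤ 1 / 50)
    (hA : 8 * Real.pi ^ 2 * (lo / Λ) * (M * W.period) * (1 + c) / K ^ 2 * g₀
      ≤ 1 / (50 * (2 * Real.sqrt 2 * C * (hi * Λ ^ 2 / lo) + 1)))
    (hB : 12 * k * Real.exp (9 * (k : ℝ) ^ 2 / (2 * Real.pi ^ 4 * (lo / Λ) ^ 2 * c)) / (Real.pi ^ 2 * (lo / Λ) * K) * g₀ ≤ 1 / 50)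
    (hBs : 24 * (∑ j, ‖slotAmp W j‖) / (Real.pi * (lo / Λ) * K) * g₀ ≤ 1 / 50)
    (hgd : 16 * (1 + c) * g₀ / K ^ 2 ≤ 1 / 50) :
    8 * Real.pi ^ 2 * loT lo Λ c ν n * Torus.freqNormSq ℓ * (M * W.period / ν) ≤ 1 ∧
    Real.exp (-(1 / 2 : ℝ))
        + 2 * Real.sqrt 2 * (C * (C * (ν ^ σ + (‖Torus.latticeVec ℓ‖ * (⌈K / ν⌉₊ : ℝ) / n) ^ σ)
            + (8 * Real.pi ^ 2 * ‖Torus.latticeVec ℓ‖ ^ 2 * (hi * Λ) * (ν + c / ν) / (n:ℝ) ^ 2) * (M * W.period / ν)))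
        + (12 * k * (Real.sqrt (freqNormSq ℓ) / n) / (Real.pi ^ 2 * (ν * (lo / Λ))))
            * Real.exp (9 * (k : ℝ) ^ 2 / (2 * Real.pi ^ 4 * (lo / Λ) ^ 2 * c))
        + 3 * (8 * (Real.sqrt (freqNormSq ℓ) / n) * (∑ j, ‖slotAmp W j‖) / (Real.pi * (ν * (lo / Λ))))
        + Real.exp (-(Real.pi ^ 2 * (ν * (lo / Λ)) / 2 * (1 / (8 * Real.pi ^ 2 * loT lo Λ c ν n * Torus.freqNormSq ℓ))))
      ≤ 3 / 4 := by
  -- ### scalars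
  have hn0 : (0:ℝ) < n := by exact_mod_cast (show 0 < n from hn)
  have hΛ0 : 0 < Λ := lt_of_lt_of_le one_pos hΛ
  have hloΛ : 0 < lo / Λ := div_pos hlo hΛ0
  have hWp := PermissibleCarrier.period_pos W
  have hMW : 0 < M * W.period := mul_pos hM hWp
  have hL0 : 0 < ‖Torus.latticeVec ℓ‖ := by
    refine norm_pos_iff.2 fun h => hℓ0 ?_
    funext i
    have hi := congrArg (fun w : EuclideanSpace ℝ (Fin 3) => w i) h
    simpa [Torus.latticeVec_apply] using hi
  set L : ℝ := ‖Torus.latticeVec ℓ‖ with hL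
  set q : ℝ := Torus.freqNormSq ℓ with hq
  have hqL : q = L ^ 2 := by rw [hq, hL, norm_latticeVec_sq_eq]
  have hq0 : 0 < q := by rw [hqL]; positivity
  have hsqrtq : Real.sqrt q = L := by rw [hqL, Real.sqrt_sq hL0.le]
  set r₀ : ℝ := hi * Λ ^ 2 / lo with hr₀
  have hr₀0 : 0 ≤ r₀ := by rw [hr₀]; positivity
  set E₁ : ℝ := 9 * (k : ℝ) ^ 2 / (2 * Real.pi ^ 4 * (lo / Λ) ^ 2 * c) with hE₁
  set S : ℝ := ∑ j, ‖slotAmp W j‖ with hS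
  have hS0 : 0 ≤ S := by rw [hS]; positivity
  -- ### coarseness: `L/(nν) ≤ g₀/K`
  have hceil : K / ν ≤ (⌈K / ν⌉₊ : ℝ) := Nat.le_ceil _
  have hLnν : L / (n * ν) ≤ g₀ / K := by
    have h1 : L * (K / ν) ≤ g₀ * n := (mul_le_mul_of_nonneg_left hceil hL0.le).trans hcoarse
    rw [div_le_div_iff₀ (by positivity) hK]
    have := mul_le_mul_of_nonneg_right h1 hν.le
    calc L * K = L * (K / ν) * ν := by field_simp
      _ ≤ g₀ * n * ν := this
      _ = g₀ * (n * ν) := by ring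
  have hLnν0 : 0 ≤ L / (n * ν) := by positivity
  -- `q/(n²ν²) ≤ g₀²/K²`
  have hqn : q / ((n:ℝ) ^ 2 * ν ^ 2) ≤ g₀ ^ 2 / K ^ 2 := by
    have := pow_le_pow_left₀ hLnν0 hLnν 2
    rw [div_pow, div_pow, mul_pow] at this
    rwa [hqL]
  -- ### `u = RP ≤ 8π²(lo/Λ)MW(1+c)g₀²/K² ≤ … ≤ 1`
  set u : ℝ := 8 * Real.pi ^ 2 * loT lo Λ c ν n * q * (M * W.period / ν) with hu
  have hu_eq : u = 8 * Real.pi ^ 2 * (lo / Λ) * (M * W.period) * ((ν ^ 2 + c) * (q / ((n:ℝ) ^ 2 * ν ^ 2))) := by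
    rw [hu]; unfold loT; field_simp
  have hu_le : u ≤ 8 * Real.pi ^ 2 * (lo / Λ) * (M * W.period) * (1 + c) / K ^ 2 * g₀ ^ 2 := by
    rw [hu_eq]
    have h1 : (ν ^ 2 + c) * (q / ((n:ℝ) ^ 2 * ν ^ 2)) ≤ (1 + c) * (g₀ ^ 2 / K ^ 2) :=
      mul_le_mul (by nlinarith) hqn (by positivity) (by positivity)
    have := mul_le_mul_of_nonneg_left h1 (by positivity : 0 ≤ 8 * Real.pi ^ 2 * (lo / Λ) * (M * W.period))
    refine this.trans (le_of_eq ?_); ring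
  have hδ : u ≤ 1 / (50 * (2 * Real.sqrt 2 * C * r₀ + 1)) := by
    refine hu_le.trans (le_trans ?_ hA)
    have h0 : 0 ≤ 8 * Real.pi ^ 2 * (lo / Λ) * (M * W.period) * (1 + c) / K ^ 2 := by positivity
    have : g₀ ^ 2 ≤ g₀ := by nlinarith
    exact mul_le_mul_of_nonneg_left this h0
  have hu1 : u ≤ 1 := hδ.trans (by
    rw [div_le_one (by positivity)]; nlinarith [mul_nonneg (mul_nonneg (by positivity : (0:ℝ) ≤ 2 * Real.sqrt 2) hC) hr₀0])
  refine ⟨hu1, ?_⟩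
  -- ### the five small terms
  -- (1) `2√2C²ν^σ ≤ 1/50`
  have h1 : 2 * Real.sqrt 2 * C ^ 2 * ν ^ σ ≤ 1 / 50 :=
    (mul_le_mul_of_nonneg_left (Real.rpow_le_rpow hν.le hνc hσ.le) (by positivity)).trans hνcσ
  -- (2) `2√2C²g^σ ≤ 1/50`
  have hgg₀ : L * (⌈K / ν⌉₊ : ℝ) / n ≤ g₀ := by rw [div_le_iff₀ hn0]; exact hcoarse
  have h2 : 2 * Real.sqrt 2 * C ^ 2 * (L * (⌈K / ν⌉₊ : ℝ) / n) ^ σ ≤ 1 / 50 :=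
    (mul_le_mul_of_nonneg_left (Real.rpow_le_rpow (by positivity) hgg₀ hσ.le) (by positivity)).trans hgσ
  -- (3) `2√2·C·ξP = 2√2·C·r₀·u ≤ 1/50`
  have hξP : (8 * Real.pi ^ 2 * L ^ 2 * (hi * Λ) * (ν + c / ν) / (n:ℝ) ^ 2) * (M * W.period / ν) = r₀ * u := by
    rw [hu, hr₀, hqL]; unfold loT; field_simp
  have h3 : 2 * Real.sqrt 2 * C * (r₀ * u) ≤ 1 / 50 := by
    have hx0 : 0 ≤ 2 * Real.sqrt 2 * C * r₀ := by positivity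
    have := mul_le_mul_of_nonneg_left hδ hx0
    calc 2 * Real.sqrt 2 * C * (r₀ * u) = 2 * Real.sqrt 2 * C * r₀ * u := by ring
      _ ≤ 2 * Real.sqrt 2 * C * r₀ * (1 / (50 * (2 * Real.sqrt 2 * C * r₀ + 1))) := this
      _ ≤ 1 / 50 := by
          rw [mul_one_div, div_le_div_iff₀ (by positivity) (by norm_num)]; nlinarith
  -- (4) `cL^* ≤ B·g₀ ≤ 1/50`
  have h4 : (12 * k * (Real.sqrt q / n) / (Real.pi ^ 2 * (ν * (lo / Λ)))) * Real.exp E₁ ≤ 1 / 50 := by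
    refine le_trans ?_ hB
    have e1 : (12 * k * (Real.sqrt q / n) / (Real.pi ^ 2 * (ν * (lo / Λ)))) * Real.exp E₁
        = 12 * k * Real.exp E₁ / (Real.pi ^ 2 * (lo / Λ) * K) * (K * (L / (n * ν))) := by
      rw [hsqrtq]; field_simp
    rw [e1]
    refine mul_le_mul_of_nonneg_left ?_ (by positivity)
    calc K * (L / (n * ν)) ≤ K * (g₀ / K) := mul_le_mul_of_nonneg_left hLnν hK.le
      _ = g₀ := by field_simp
  -- (5) `3cS ≤ Bs·g₀ ≤ 1/50`
  have h5 : 3 * (8 * (Real.sqrt q / n) * S / (Real.pi * (ν * (lo / Λ)))) ≤ 1 / 50 := by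
    refine le_trans ?_ hBs
    have e1 : 3 * (8 * (Real.sqrt q / n) * S / (Real.pi * (ν * (lo / Λ)))) = 24 * S / (Real.pi * (lo / Λ) * K) * (K * (L / (n * ν))) := by
      rw [hsqrtq]; field_simp; ring
    rw [e1]
    refine mul_le_mul_of_nonneg_left ?_ (by positivity)
    calc K * (L / (n * ν)) ≤ K * (g₀ / K) := mul_le_mul_of_nonneg_left hLnν hK.le
      _ = g₀ := by field_simp
  -- (6) `κ^* ≤ 16(1+c)g₀²/K² ≤ 1/50`
  have h6 : Real.exp (-(Real.pi ^ 2 * (ν * (lo / Λ)) / 2 * (1 / (8 * Real.pi ^ 2 * loT lo Λ c ν n * q)))) ≤ 1 / 50 := by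
    -- the exponent is at least `K²/(16(1+c)g₀²)`
    have hR0 : 0 < 8 * Real.pi ^ 2 * loT lo Λ c ν n * q := by
      unfold loT; have : 0 < ν + c / ν := by positivity
      positivity
    have hY0 : 0 < K ^ 2 / (16 * (1 + c) * g₀ ^ 2) := by positivity
    have hexp : Real.pi ^ 2 * (ν * (lo / Λ)) / 2 * (1 / (8 * Real.pi ^ 2 * loT lo Λ c ν n * q)) ≥ K ^ 2 / (16 * (1 + c) * g₀ ^ 2) := by
      -- `= n²ν²/(16(ν²+c)q)`
      have e1 : Real.pi ^ 2 * (ν * (lo / Λ)) / 2 * (1 / (8 * Real.pi ^ 2 * loT lo Λ c ν n * q))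
          = 1 / (16 * ((ν ^ 2 + c) * (q / ((n:ℝ) ^ 2 * ν ^ 2)))) := by
        unfold loT; field_simp; norm_num
      rw [e1, ge_iff_le, div_le_div_iff₀ (by positivity) (by positivity), one_mul]
      have h1 : (ν ^ 2 + c) * (q / ((n:ℝ) ^ 2 * ν ^ 2)) ≤ (1 + c) * (g₀ ^ 2 / K ^ 2) :=
        mul_le_mul (by nlinarith) hqn (by positivity) (by positivity)
      have := mul_le_mul_of_nonneg_left h1 (by positivity : (0:ℝ) ≤ 16 * K ^ 2)
      calc K ^ 2 * (16 * ((ν ^ 2 + c) * (q / ((n:ℝ) ^ 2 * ν ^ 2)))) = 16 * K ^ 2 * ((ν ^ 2 + c) * (q / ((n:ℝ) ^ 2 * ν ^ 2))) := by ring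
        _ ≤ 16 * K ^ 2 * ((1 + c) * (g₀ ^ 2 / K ^ 2)) := this
        _ = 16 * (1 + c) * g₀ ^ 2 := by field_simp
    have hexp' : Real.exp (-(Real.pi ^ 2 * (ν * (lo / Λ)) / 2 * (1 / (8 * Real.pi ^ 2 * loT lo Λ c ν n * q))))
        ≤ Real.exp (-(K ^ 2 / (16 * (1 + c) * g₀ ^ 2))) := Real.exp_le_exp.2 (neg_le_neg hexp)
    refine hexp'.trans ?_
    -- `e^{−Y} ≤ 1/Y = 16(1+c)g₀²/K² ≤ 16(1+c)g₀/K² ≤ 1/50`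
    have hY : Real.exp (-(K ^ 2 / (16 * (1 + c) * g₀ ^ 2))) ≤ 1 / (K ^ 2 / (16 * (1 + c) * g₀ ^ 2)) := by
      rw [Real.exp_neg, ← one_div]
      exact one_div_le_one_div_of_le hY0 (by linarith [Real.add_one_le_exp (K ^ 2 / (16 * (1 + c) * g₀ ^ 2))])
    refine hY.trans ?_
    rw [one_div_div]
    calc 16 * (1 + c) * g₀ ^ 2 / K ^ 2 ≤ 16 * (1 + c) * g₀ / K ^ 2 := by
          refine div_le_div_of_nonneg_right ?_ (by positivity)
          have : g₀ ^ 2 ≤ g₀ := by nlinarith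
          exact mul_le_mul_of_nonneg_left this (by positivity)
      _ ≤ 1 / 50 := hgd
  -- ### sum
  have h0 := exp_neg_half_lt
  have hcV : 2 * Real.sqrt 2 * (C * (C * (ν ^ σ + (L * (⌈K / ν⌉₊ : ℝ) / n) ^ σ)
      + (8 * Real.pi ^ 2 * L ^ 2 * (hi * Λ) * (ν + c / ν) / (n:ℝ) ^ 2) * (M * W.period / ν))) ≤ 3 / 50 := by
    rw [hξP]
    have : 2 * Real.sqrt 2 * (C * (C * (ν ^ σ + (L * (⌈K / ν⌉₊ : ℝ) / n) ^ σ) + r₀ * u))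
        = 2 * Real.sqrt 2 * C ^ 2 * ν ^ σ + 2 * Real.sqrt 2 * C ^ 2 * (L * (⌈K / ν⌉₊ : ℝ) / n) ^ σ + 2 * Real.sqrt 2 * C * (r₀ * u) := by
      ring
    rw [this]; linarith
  linarith

end Summit.AnomalousDissipation.AnomalousDissipation.Theorems.SolenoidalFractalHomogenisation.LagrangianStep.VmodGen

end
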